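import Literature.NumberTheory.Automorphic.CDTTheorem712ConductorStepProofs
import Literature.NumberTheory.Automorphic.CDTTheorem722
import Literature.NumberTheory.EllipticCurves.InertiaInvariantsAdditiveProofs
import Literature.NumberTheory.EllipticCurves.TateModuleFixedPointsProofs
import Literature.NumberTheory.EllipticCurves.TateModuleContinuityProofs
import Literature.NumberTheory.EllipticCurves.SzpiroLocalDataProofs
import Literature.NumberTheory.EllipticCurves.SzpiroFreyProofs
import Literature.NumberTheory.EllipticCurves.RootNumberProofs
import Literature.NumberTheory.DiophantineGeometry.ConductorAdditiveProofs
import Literature.NumberTheory.DiophantineGeometry.ConductorFactorizationProofs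
import Literature.NumberTheory.DiophantineGeometry.ConductorRingOfIntegersProofs
import Literature.NumberTheory.DiophantineGeometry.ConductorMultiplicativeProofs
import Literature.NumberTheory.DiophantineGeometry.LocalReductionIsIntegralAtProofs
import Literature.NumberTheory.DiophantineGeometry.LocalReductionHasMultiplicativeReductionAtProofs
import Literature.NumberTheory.DiophantineGeometry.PastenValuationProductsProofs
import HarnessLib

/-!
# Stub-ideation companion (k = 3, GEN 5 — family "probe the extremes") for `stub_liftFive`

Crux `FreyModularity` (stmt-ABC-11340), line `Sketch` (sha 21576c53), stub `stub_liftFive` (verbatim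
in `liftFiveWilesCorner_of_liftFive` below).  Gen 4 (same slot, `STUB_IDEAS_stub_liftFive_3g4.lean`,
still valid) pinned the CURVE `E` at `5` (case B ⇒ `5 ∣ abc` ⇒ multiplicative at `5`, proved) and
proposed the ordinary engine S2″.  GEN 5 pins the PARTNER curve `E'` of the `3`–`5` switch:

* §1 **semistability transfers along `E[5] ≅ E'[5]` at every prime `p ≠ 5`** — the landed
  `stub_nineTransfer` (`p = 3`, p110220) perturbed to all `p ≠ 5`; PROVED here from the two landed
  summit theorems it rests on, entered as hypotheses of their exact (`K = ℚ`) shapes because the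
  `Summits.ABC.ABC.Theorems.DefiniteXi…` modules are `remote:stale:…:unbuilt` on the farm snapshot
  (`FixedTorsionShape` ↦ `Summit.ABC.ABC.Theorems.exists_ne_zero_smul_eq_of_not_hasAdditiveReductionAt`,
  `TorsionVanishingShape` ↦ `Summit.ABC.ABC.Theorems.stub_nineTransfer_torsion`).
* §2 **at `p = 5` it does not transfer, but congruence MOD 5 of integral models does**: an integral
  model congruent mod `p` to one with `p ∤ c₄`, `p ∣ Δ` is multiplicative at `p` (PROVED; the
  effective form of "taking `E'` sufficiently close `5`-adically to `E`", Stevens in CSS 1997 (7.10));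
  the Frey model `y² = x(x − A)(x + B)` has `5 ∤ c₄ = 16(A² + AB + B²)`, `5 ∣ Δ` once `5 ∣ AB(A+B)`
  (PROVED), so radius `5⁻¹` around the Frey equation suffices.  Book-keeping `mult ⇒ p ∥ N`,
  `(∀ p, p² ∤ N) ⇒ semistable` PROVED.
* §3 the **Wiles corner** engine `LiftFiveWilesCorner` (both curves semistable, both multiplicative at
  `5`: Wiles 1995 Thm 0.2 (I) + Taylor–Wiles, squarefree level, `5`-ordinary on both sides) — the
  file's ONLY `sorry` — with closers from the registered `stub_liftFive`, from gen-4's S2″ and from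
  `CDT_theorem_7_2_2`, and the case-B consumer, all kernel-checked; plus the two interface shapes the
  switch lane (`SwitchMultFive`), statement only.  Un-normalised presentations `E_(a,b)` (which can be
  ADDITIVE at `2`, e.g. `E_(32,-5) = E_(-5,32)^{(-1)}`, `N = 240`) are re-glued exactly as in gen 3 of this
  slot (`STUB_IDEAS_stub_liftFive_3g3.lean` §2–§3: normalisation H1, `isModular_smul_iff`, and the `-1`-twist
  invariance H3 `isModular_quadraticTwist_neg_one_of_two_facts` granted Eichler–Shimura + Carayol), so E5
  simply takes the place of gen-3's `LiftFiveSemistable` in `isModular_freyCurve_of_stubs_semistable`.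
-/

set_option linter.dupNamespace false

noncomputable section

open scoped MatrixGroups NumberField
open Matrix Field IsDedekindDomain
open Literature.NumberTheory.EllipticCurves
open Literature.NumberTheory.Automorphic
open Literature.NumberTheory.Automorphic.BCDT
open Literature.NumberTheory.GaloisRepresentations
open Literature.NumberTheory.DiophantineGeometry
open WeierstrassCurve

namespace Summit.ABC.ABC.Cruxes.FreyModularity.StubIdeas.LiftFive3g5

/-! ## §1 Semistability transfers along `E[5] ≅ E'[5]` at every `p ≠ 5` -/

/-- Shape (`K = ℚ`) of the landed `Summit.ABC.ABC.Theorems.exists_ne_zero_smul_eq_of_not_hasAdditiveReductionAt`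
(Silverman *ATAEC* Thm. IV.10.2(a): at a non-additive place `v ∤ ℓ`, `E[ℓ]^{I_𝔓} ≠ 0`). -/
def FixedTorsionShape : Prop :=
  ∀ (W : WeierstrassCurve ℚ) [W.IsElliptic] (ℓ : ℕ) [Fact ℓ.Prime] {v : HeightOneSpectrum (𝓞 ℚ)},
    (ℓ : 𝓞 ℚ) ∉ v.asIdeal → ¬ W.HasAdditiveReductionAt v →
    ∀ {𝔓 : Ideal (absIntegers (𝓞 ℚ) ℚ)}, 𝔓 ∈ v.primesAbove →
      ∃ P : geomPoints W, P ≠ 0 ∧ ℓ • P = 0 ∧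
        ∀ σ ∈ 𝔓.inertia (absoluteGaloisGroup ℚ), σ • P = P

/-- Shape (`K = ℚ`) of the landed `Summit.ABC.ABC.Theorems.stub_nineTransfer_torsion`
(Kodaira–Néron: at an additive place `v ∤ ℓ`, `ℓ ≥ 5`, `E[ℓ]^{I_𝔓} = 0` since `c_v ≤ 4`). -/
def TorsionVanishingShape : Prop :=
  ∀ (W : WeierstrassCurve ℚ) [W.IsElliptic] {ℓ : ℕ}, ℓ.Prime → 4 < ℓ →
    ∀ {v : HeightOneSpectrum (𝓞 ℚ)}, (ℓ : 𝓞 ℚ) ∉ v.asIdeal → W.HasAdditiveReductionAt v →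
    ∀ {𝔓 : Ideal (absIntegers (𝓞 ℚ) ℚ)}, 𝔓 ∈ v.primesAbove →
    ∀ P : geomPoints W, ℓ • P = 0 →
      (∀ σ ∈ 𝔓.inertia (absoluteGaloisGroup ℚ), σ • P = P) → P = 0

/-- `p² ∣ N_E` iff `E` is additive at the place of `𝓞 ℚ` above `p` (verbatim the landed
`Summit.ABC.ABC.Theorems.sq_dvd_conductorNorm_iff_hasAdditiveReductionAt`, re-proved here because its
module is unbuilt on the farm). [cite: SilvermanATAEC1994, Thm. IV.10.2(a)] -/
theorem sq_dvd_conductorNorm_iff_hasAdditiveReductionAt (W : WeierstrassCurve ℚ) [W.IsElliptic]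
    {p : ℕ} (hp : p.Prime) {v : HeightOneSpectrum (𝓞 ℚ)}
    (hv : (Rat.HeightOneSpectrum.primesEquiv v : ℕ) = p) :
    p ^ 2 ∣ W.conductorNorm ℤ ↔ W.HasAdditiveReductionAt v := by
  classical
  set pp : Nat.Primes := ⟨p, hp⟩ with hpp
  have hvp : Rat.HeightOneSpectrum.primesEquiv v = pp := Subtype.ext hv
  set vZ : HeightOneSpectrum ℤ := (Rat.HeightOneSpectrum.primesEquiv (R := ℤ)).symm pp with hvZ
  have hfac := factorization_conductorNorm_holds W vZ
  have hgen : Rat.HeightOneSpectrum.natGenerator vZ = p := by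
    change ((Rat.HeightOneSpectrum.primesEquiv vZ : Nat.Primes) : ℕ) = p
    rw [hvZ, Equiv.apply_symm_apply]
  rw [hgen] at hfac
  have hf : W.conductorExponent v = W.conductorExponent vZ := by
    rw [conductorExponent_ringOfIntegers_eq W v, hvp]
  rw [Nat.Prime.pow_dvd_iff_le_factorization hp (conductorNorm_pos_holds W).ne', hfac, ← hf,
    two_le_conductorExponent_iff_holds v W]

/-- A common framed model of `E[n]` and `E'[n]` transports `Γ`-fixed torsion points (verbatim the
landed `Summit.ABC.ABC.Theorems.exists_torsion_of_isTorsionGaloisRep`). [folklore] -/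
theorem exists_torsion_of_isTorsionGaloisRep {F : Type*} [Field F] {W W' : WeierstrassCurve F}
    {n : ℕ} {ρ : FramedGaloisRep F (ZMod n) 2} (hρ : W.IsTorsionGaloisRep n ρ)
    (hρ' : W'.IsTorsionGaloisRep n ρ) (P : geomTorsion W n) :
    ∃ P' : geomTorsion W' n, (P' = 0 ↔ P = 0) ∧
      ∀ σ : absoluteGaloisGroup F, σ • P = P → σ • P' = P' := by
  obtain ⟨e, he⟩ := hρ
  obtain ⟨e', he'⟩ := hρ'
  refine ⟨e'.symm (e P), ?_, fun σ hσ ↦ ?_⟩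
  · rw [map_eq_zero_iff _ e'.symm.injective, map_eq_zero_iff _ e.injective]
  · apply e'.injective
    rw [he', AddEquiv.apply_symm_apply, ← he, hσ]

/-- **T1 — semistability at `p` transfers along `E[5] ≅ E'[5]` for EVERY prime `p ≠ 5`** (Silverberg,
CSS 1997, Prop. 7.1 is `p = 3`; same proof: `E` not additive at `v ∣ p` ⇒ `E[5]^{I_𝔓} ∋ P ≠ 0`,
transported to `E'[5]^{I_𝔓}`, which vanishes if `E'` is additive at `v` because `5 > 4 ≥ c_v(E')`).
The landed `stub_nineTransfer` is the case `p = 3`; in `Theorems/` the two shape hypotheses are the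
landed theorems named in their docstrings. [cite: SilverbergCSS1997, Prop. 7.1] -/
theorem sq_dvd_conductorNorm_transfer (hFix : FixedTorsionShape) (hVan : TorsionVanishingShape) :
    ∀ (W W' : WeierstrassCurve ℚ) [W.IsElliptic] [W'.IsElliptic] (ρ : ModPGaloisRep ℚ (ZMod 5) 2),
      W.IsTorsionGaloisRep 5 ρ → W'.IsTorsionGaloisRep 5 ρ →
      ∀ {p : ℕ}, p.Prime → p ≠ 5 → ¬ p ^ 2 ∣ W.conductorNorm ℤ → ¬ p ^ 2 ∣ W'.conductorNorm ℤ := by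
  intro W W' _ _ ρ hρ hρ' p hp hp5 hW2 hW'2
  classical
  -- the place `v` of `𝓞 ℚ` above `p`, not above `5`, and a prime `𝔓 ∣ v` of `\bar ℤ`
  set v : HeightOneSpectrum (𝓞 ℚ) :=
    (Rat.HeightOneSpectrum.primesEquiv (R := 𝓞 ℚ)).symm ⟨p, hp⟩ with hv
  have hvp : (Rat.HeightOneSpectrum.primesEquiv v : ℕ) = p := by rw [hv, Equiv.apply_symm_apply]
  have h5v : ((5 : ℕ) : 𝓞 ℚ) ∉ v.asIdeal := by
    rw [natCast_mem_asIdeal_iff_eq_primesEquiv_symm v Nat.prime_five, hv,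
      (Rat.HeightOneSpectrum.primesEquiv (R := 𝓞 ℚ)).symm.injective.eq_iff]
    intro h
    exact hp5 (congrArg Subtype.val h)
  obtain ⟨𝔓, h𝔓⟩ := HeightOneSpectrum.primesAbove_nonempty v
  -- `E` is not additive at `p`, `E'` is
  have hW : ¬ W.HasAdditiveReductionAt v := by
    rw [← sq_dvd_conductorNorm_iff_hasAdditiveReductionAt W hp hvp]
    exact hW2
  have hW' : W'.HasAdditiveReductionAt v := by
    rw [← sq_dvd_conductorNorm_iff_hasAdditiveReductionAt W' hp hvp]
    exact hW'2
  -- a non-zero `5`-torsion point of `E` fixed by `I_𝔓`, transported to `E'`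
  obtain ⟨P₀, hP₀0, hP₀5, hP₀fix⟩ := hFix W 5 h5v hW h𝔓
  set P : geomTorsion W ((5 : ℕ) : ℤ) := ⟨P₀, AddSubgroup.torsionBy.nsmul_iff.mpr hP₀5⟩ with hPdef
  obtain ⟨P', hP'0, hP'fix⟩ := exists_torsion_of_isTorsionGaloisRep hρ hρ' P
  have hPfix : ∀ σ ∈ 𝔓.inertia (absoluteGaloisGroup ℚ), σ • P = P := fun σ hσ ↦
    Subtype.ext (by rw [AddSubgroup.torsionBy.coe_smul]; exact hP₀fix σ hσ)
  -- `P' = O` by the vanishing of `E'[5]^{I_𝔓}` at the additive place `p ≠ 5`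
  have hP'5 : 5 • (P' : geomPoints W') = 0 := AddSubgroup.torsionBy.nsmul_iff.mp P'.2
  have hP'zero : (P' : geomPoints W') = 0 :=
    hVan W' Nat.prime_five (by norm_num) h5v hW' h𝔓 (P' : geomPoints W') hP'5
      (fun σ hσ ↦ by rw [← AddSubgroup.torsionBy.coe_smul, hP'fix σ (hPfix σ hσ)])
  have hP'eq : P' = 0 := Subtype.ext hP'zero
  have hPeq : P = 0 := hP'0.mp hP'eq
  exact hP₀0 (congrArg Subtype.val hPeq)

/-- A semistable curve has `p² ∤ N` for every prime `p` (squarefree conductor). [folklore] -/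
theorem not_sq_dvd_conductorNorm_of_isSemistable (W : WeierstrassCurve ℚ) [W.IsElliptic]
    (hss : W.IsSemistable ℤ) {p : ℕ} (hp : p.Prime) : ¬ p ^ 2 ∣ W.conductorNorm ℤ := by
  intro h
  have hsq : Squarefree (W.conductorNorm ℤ) := (isSemistable_iff_squarefree_conductorNorm W).mp hss
  have hu : IsUnit p := hsq p (by rwa [← sq])
  exact hp.one_lt.ne' (Nat.isUnit_iff.mp hu)

/-- Conversely `(∀ p prime, p² ∤ N) ⇒` semistable. [folklore] -/
theorem isSemistable_of_forall_not_sq_dvd (W : WeierstrassCurve ℚ) [W.IsElliptic]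
    (h : ∀ p : ℕ, p.Prime → ¬ p ^ 2 ∣ W.conductorNorm ℤ) : W.IsSemistable ℤ := by
  rw [isSemistable_iff_squarefree_conductorNorm, Nat.squarefree_iff_prime_squarefree]
  intro p hp hpp
  exact h p hp (by rwa [sq])

/-- **T1′ — if `E` is semistable then `E'` is semistable at every `p ≠ 5`.** [cite: SilverbergCSS1997, Prop. 7.1] -/
theorem not_sq_dvd_conductorNorm_transfer_of_isSemistable (hFix : FixedTorsionShape)
    (hVan : TorsionVanishingShape) (W W' : WeierstrassCurve ℚ) [W.IsElliptic] [W'.IsElliptic]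
    (ρ : ModPGaloisRep ℚ (ZMod 5) 2) (hρ : W.IsTorsionGaloisRep 5 ρ) (hρ' : W'.IsTorsionGaloisRep 5 ρ)
    (hss : W.IsSemistable ℤ) {p : ℕ} (hp : p.Prime) (hp5 : p ≠ 5) :
    ¬ p ^ 2 ∣ W'.conductorNorm ℤ :=
  sq_dvd_conductorNorm_transfer hFix hVan W W' ρ hρ hρ' hp hp5
    (not_sq_dvd_conductorNorm_of_isSemistable W hss hp)

/-! ## §2 At `p = 5`: congruence mod `p` of integral models transfers multiplicative reduction -/

/-- **Multiplicative reduction at `p` reads `p ∥ N`**: `p ∣ N_E` and `p² ∤ N_E`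
(`f_p = 1`, Silverman *ATAEC* IV.10.2(b)). [cite: SilvermanATAEC1994, Thm. IV.10.2(b)] -/
theorem dvd_and_not_sq_dvd_of_hasMultiplicativeReductionAtPrime (W : WeierstrassCurve ℚ)
    [W.IsElliptic] {p : ℕ} [hp : Fact p.Prime] (hm : W.HasMultiplicativeReductionAtPrime p) :
    p ∣ W.conductorNorm ℤ ∧ ¬ p ^ 2 ∣ W.conductorNorm ℤ := by
  have hfac : (W.conductorNorm ℤ).factorization p = 1 := by
    rw [show p = ((⟨p, hp.out⟩ : Nat.Primes) : ℕ) from rfl, factorization_conductorNorm_primesEquiv_symm]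
    exact (conductorExponent_eq_one_iff_holds _ W).mpr
      (((hasMultiplicativeReductionAtPrime_iff_hasMultiplicativeReductionAt_holds W) ⟨p, hp.out⟩).mp hm)
  have hN : W.conductorNorm ℤ ≠ 0 := (conductorNorm_pos_holds W).ne'
  refine ⟨?_, ?_⟩
  · have h1 := (Nat.Prime.pow_dvd_iff_le_factorization hp.out hN (k := 1)).mpr (by omega)
    rwa [pow_one] at h1
  · rw [Nat.Prime.pow_dvd_iff_le_factorization hp.out hN]
    omega

/-- **T3 — multiplicative reduction is an open condition of radius `p⁻¹` on integral models.**  If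
`W₀, W₀'` are integral Weierstrass equations congruent mod `p` (same image in `(ℤ/p)`-equations) and
`p ∤ c₄(W₀)`, `p ∣ Δ(W₀)`, then `W₀' ⊗ ℚ` (elliptic) has multiplicative reduction at `p`: `c₄`, `Δ` are
integer polynomials in the `aᵢ`, so `p ∤ c₄(W₀')`, `p ∣ Δ(W₀')`, and Silverman's criterion applies to
the integral equation `W₀'` (AEC VII.5.1(b) with VII.1 Rem. 1.1). This is the effective content of
"taking `E'` in this family sufficiently close `5`-adically to `E`" (Stevens, CSS 1997, (7.10)).
[cite: SilvermanAEC2009, VII.5 Prop. 5.1(b), VII.1 Remark 1.1] -/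
theorem hasMultiplicativeReductionAtPrime_of_map_eq (W₀ W₀' : WeierstrassCurve ℤ)
    [(W₀'.baseChange ℚ).IsElliptic] {p : ℕ} [hp : Fact p.Prime]
    (hcong : W₀.map (Int.castRingHom (ZMod p)) = W₀'.map (Int.castRingHom (ZMod p)))
    (hc₄ : ¬ (p : ℤ) ∣ W₀.c₄) (hΔ : (p : ℤ) ∣ W₀.Δ) :
    (W₀'.baseChange ℚ).HasMultiplicativeReductionAtPrime p := by
  have ec₄ : (p : ℤ) ∣ W₀'.c₄ - W₀.c₄ := by
    rw [← ZMod.intCast_eq_intCast_iff_dvd_sub]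
    have h := congrArg WeierstrassCurve.c₄ hcong
    simpa [WeierstrassCurve.map_c₄] using h
  have eΔ : (p : ℤ) ∣ W₀'.Δ - W₀.Δ := by
    rw [← ZMod.intCast_eq_intCast_iff_dvd_sub]
    have h := congrArg WeierstrassCurve.Δ hcong
    simpa [WeierstrassCurve.map_Δ] using h
  have hc₄' : ¬ (p : ℤ) ∣ W₀'.c₄ := by
    intro h
    apply hc₄
    have h2 := dvd_sub h ec₄
    rwa [sub_sub_cancel] at h2
  have hΔ' : (p : ℤ) ∣ W₀'.Δ := by
    have h2 := dvd_add hΔ eΔ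
    rwa [add_sub_cancel] at h2
  set v := (Rat.HeightOneSpectrum.primesEquiv (R := ℤ)).symm ⟨p, hp.out⟩ with hv
  have hgen : Rat.HeightOneSpectrum.natGenerator v = p := Rat.natGenerator_primesEquiv_symm ⟨p, hp.out⟩
  refine ((W₀'.baseChange ℚ).hasMultiplicativeReductionAtPrime_iff_hasMultiplicativeReductionAt_holds
    ⟨p, hp.out⟩).mpr ?_
  refine hasMultiplicativeReductionAt_of_valuation_c₄_eq_one (isIntegralAt_baseChange v W₀') ?_ ?_
  · rw [baseChange_int_c₄, Rat.valuation_intCast_eq_one_iff, hgen]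
    exact hc₄'
  · rw [baseChange_int_Δ, Rat.valuation_intCast_lt_one_iff, hgen]
    exact hΔ'

/-- **The Frey equation is a centre of such a disc at `5`**: if `5 ∣ AB(A+B)` (`A, B` coprime) then
`5 ∤ c₄ = 16(A² + AB + B²)` and `5 ∣ Δ = 16(AB(A+B))²` for `y² = x(x − A)(x + B)`, so every elliptic
integral equation congruent to it mod `5` is multiplicative at `5`. [cite: Serre1987, §4.1 (4.1.2)] -/
theorem hasMultiplicativeReductionAtPrime_five_of_map_eq_freyIntModel {A B : ℤ} (hAB : IsCoprime A B)
    (h5 : (5 : ℤ) ∣ A * B * (A + B)) (W₀' : WeierstrassCurve ℤ) [(W₀'.baseChange ℚ).IsElliptic]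
    (hcong : (freyIntModel A B).map (Int.castRingHom (ZMod 5)) = W₀'.map (Int.castRingHom (ZMod 5))) :
    (W₀'.baseChange ℚ).HasMultiplicativeReductionAtPrime 5 := by
  refine hasMultiplicativeReductionAtPrime_of_map_eq (freyIntModel A B) W₀' hcong ?_ ?_
  · rw [freyIntModel_c₄]
    intro hc
    have hpint : Prime ((5 : ℕ) : ℤ) := Nat.prime_iff_prime_int.mp Nat.prime_five
    rcases hpint.dvd_or_dvd hc with hc | hc
    · exact absurd (eq_two_of_dvd_sixteen Nat.prime_five hc) (by norm_num)
    · exact not_dvd_sq_add_mul_add_sq hAB Nat.prime_five h5 hc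
  · rw [freyIntModel_Δ]
    exact dvd_mul_of_dvd_right (dvd_pow h5 two_ne_zero) _

/-! ## §3 The Wiles corner engine, its closers and the case-B consumer -/

/-- Gen-4's S2″ (verbatim `LiftFive3g4.LiftFiveSemistableOrdinary`): `W` semistable, `5 ∣ N_W`,
`W[5] ≅ W'[5]` irreducible, `W'` modular ⇒ `ρ_{W,5}` modular (Wiles 1995 Thm 0.2 (I)).
[cite: Wiles1995Annals, Thm. 0.2 (I)] -/
def LiftFiveSemistableOrdinary : Prop :=
  ∀ (W W' : WeierstrassCurve ℚ) [W.IsElliptic] [W'.IsElliptic] [NeZero (W'.conductorNorm ℤ)]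
    (ρ : ModPGaloisRep ℚ (ZMod 5) 2),
    W.IsSemistable ℤ → 5 ∣ W.conductorNorm ℤ → W.IsTorsionGaloisRep 5 ρ → W'.IsTorsionGaloisRep 5 ρ →
    FramedRep.IsIrreducible ρ → BCDT.IsModular W' → W.IsModularGaloisRepTate 5

/-- **E5 — the Wiles corner** (the extremal configuration of the PAIR `(E, E')`): BOTH curves semistable
and BOTH with `5 ∣ N` (multiplicative = ordinary and `D₅`-distinguished at `5`), `E[5] ≅ E'[5]`
irreducible, `E'` modular ⇒ `ρ_{E,5}` modular.  Footprint in print: the newform of `E'` is `5`-ordinary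
of squarefree level (`a₅(E') = ±1`, no Fontaine–Laffaille / flat deformations on EITHER side), Ribet
1990 lowers it to the Serre level of `ρ̄` inside squarefree levels (`ℓ ∥ N` only: no Carayol, no vexing
primes since a semistable `ρ̄` has unipotent ramification at every `ℓ ≠ 5`), then Wiles 1995 Thm 0.2 in
the Selmer case + Taylor–Wiles (minimal `R = T`) + Wiles Thm 2.17 (induction on `Σ`).  Strictly inside
gen-4's S2″ (which allows any modular `E'`). [cite: Wiles1995Annals, Thm. 0.2 (I), Thm. 2.17, Ch. 5]
[cite: TaylorWiles1995, Thm. 1] [cite: Ribet1990, Thm. 1.1] -/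
def LiftFiveWilesCorner : Prop :=
  ∀ (W W' : WeierstrassCurve ℚ) [W.IsElliptic] [W'.IsElliptic] [NeZero (W'.conductorNorm ℤ)]
    (ρ : ModPGaloisRep ℚ (ZMod 5) 2),
    W.IsSemistable ℤ → W'.IsSemistable ℤ → 5 ∣ W.conductorNorm ℤ → 5 ∣ W'.conductorNorm ℤ →
    W.IsTorsionGaloisRep 5 ρ → W'.IsTorsionGaloisRep 5 ρ →
    FramedRep.IsIrreducible ρ → BCDT.IsModular W' → W.IsModularGaloisRepTate 5

/-- The engine stub (XL: Wiles 1995 Ch. 1–3 ordinary case + Taylor–Wiles; today closed by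
`CDT_theorem_7_2_2` via `liftFiveWilesCorner_of_CDT_theorem_7_2_2`). -/
theorem stub_liftFiveWilesCorner : LiftFiveWilesCorner := by
  sorry

/-- `25 ∤ N` for a semistable curve. [folklore] -/
theorem not_twentyFive_dvd_of_isSemistable (W : WeierstrassCurve ℚ) [W.IsElliptic]
    (h : W.IsSemistable ℤ) : ¬ 25 ∣ W.conductorNorm ℤ := by
  have h5 := not_sq_dvd_conductorNorm_of_isSemistable W h Nat.prime_five
  norm_num at h5
  exact h5

/-- **S2″ ⇒ E5** (trivial weakening: forget the hypotheses on `W'`). [folklore] -/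
theorem liftFiveWilesCorner_of_liftFiveSemistableOrdinary (h : LiftFiveSemistableOrdinary) :
    LiftFiveWilesCorner :=
  fun W W' _ _ _ ρ hss _ h5 _ hρ hρ' hirr hW' ↦ h W W' ρ hss h5 hρ hρ' hirr hW'

/-- **S2 ⇒ E5**: the registered `stub_liftFive` shape (VERBATIM, hypothesis `hlift5`) and the landed
S4b (`Summit.ABC.ABC.Theorems.stub_absIrrSqrtFive`, hypothesis `h4b`) give the corner, by
`25 ∤ N_W` (semistable) and `ρ̄` modular from the modular `W'` (`isModular_of_isTorsionGaloisRep''`).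
So E5 is WEAKER than the registered stub. [folklore] -/
theorem liftFiveWilesCorner_of_liftFive
    (hlift5 : ∀ (W : WeierstrassCurve ℚ) [W.IsElliptic] (ρ : ModPGaloisRep ℚ (ZMod 5) 2),
      W.IsTorsionGaloisRep 5 ρ → ρ.IsAbsIrreducibleOverSqrt 5 → ¬ 25 ∣ W.conductorNorm ℤ →
      ρ.IsModular → W.IsModularGaloisRepTate 5)
    (h4b : ∀ (W : WeierstrassCurve ℚ) [W.IsElliptic], ¬ 25 ∣ W.conductorNorm ℤ →
      ∀ ρ : ModPGaloisRep ℚ (ZMod 5) 2, W.IsTorsionGaloisRep 5 ρ →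
        FramedRep.IsIrreducible ρ → ρ.IsAbsIrreducibleOverSqrt 5) : LiftFiveWilesCorner := by
  intro W W' _ _ _ ρ hss _ _ _ hρ hρ' hirr hW'
  have h25 := not_twentyFive_dvd_of_isSemistable W hss
  exact hlift5 W ρ hρ (h4b W h25 ρ hρ hirr) h25 (hW'.isModular_of_isTorsionGaloisRep'' hρ')

/-- **`CDT_theorem_7_2_2` ⇒ E5** (the tree's umbrella named fact still closes the reshaped stub).
[cite: ConradDiamondTaylor1999, Thm. 7.2.2] -/
theorem liftFiveWilesCorner_of_CDT_theorem_7_2_2 (h : CDT_theorem_7_2_2)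
    (h4b : ∀ (W : WeierstrassCurve ℚ) [W.IsElliptic], ¬ 25 ∣ W.conductorNorm ℤ →
      ∀ ρ : ModPGaloisRep ℚ (ZMod 5) 2, W.IsTorsionGaloisRep 5 ρ →
        FramedRep.IsIrreducible ρ → ρ.IsAbsIrreducibleOverSqrt 5) : LiftFiveWilesCorner :=
  liftFiveWilesCorner_of_liftFive
    (fun W _ ρ hρ hirr _ hmod ↦ lift_of_CDT_theorem_7_2_2 h W ρ hρ hirr hmod) h4b

/-- **The case-B consumer served by the corner.**  `E` semistable and multiplicative at `5` (case B:
gen-4 G1 `hasMultiplicativeReductionAtPrime_five_of_caseB` + S12 `isSemistable_freyCurve_of_sixteen_dvd`),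
`E'` from the strengthened switch (`E[5] ≅ E'[5]`, `E'` multiplicative at `5` by §2, `E'` modular by the
`3`-adic lane as in the skeleton): then `E'` is SEMISTABLE (§1 at `p ≠ 5`, §2 at `p = 5`) and the
corner engine applies. [cite: Wiles1995Annals, Ch. 5] [cite: StevensCSS1997, (7.10)] -/
theorem isModularGaloisRepTate_five_of_corner (hC : LiftFiveWilesCorner)
    (hFix : FixedTorsionShape) (hVan : TorsionVanishingShape)
    (W W' : WeierstrassCurve ℚ) [W.IsElliptic] [W'.IsElliptic] [NeZero (W'.conductorNorm ℤ)]
    (hss : W.IsSemistable ℤ) (hW5 : W.HasMultiplicativeReductionAtPrime 5)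
    (hW'5 : W'.HasMultiplicativeReductionAtPrime 5)
    (ρ : ModPGaloisRep ℚ (ZMod 5) 2) (hρ : W.IsTorsionGaloisRep 5 ρ) (hρ' : W'.IsTorsionGaloisRep 5 ρ)
    (hirr : FramedRep.IsIrreducible ρ) (hW' : BCDT.IsModular W') : W.IsModularGaloisRepTate 5 := by
  have hW'ss : W'.IsSemistable ℤ := isSemistable_of_forall_not_sq_dvd W' fun p hp ↦ by
    by_cases hp5 : p = 5
    · subst hp5
      exact (dvd_and_not_sq_dvd_of_hasMultiplicativeReductionAtPrime W' hW'5).2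
    · exact not_sq_dvd_conductorNorm_transfer_of_isSemistable hFix hVan W W' ρ hρ hρ' hss hp hp5
  exact hC W W' ρ hss hW'ss (dvd_and_not_sq_dvd_of_hasMultiplicativeReductionAtPrime W hW5).1
    (dvd_and_not_sq_dvd_of_hasMultiplicativeReductionAtPrime W' hW'5).1 hρ hρ' hirr hW'

/-! ### Interface shape asked of the switch lane (statement only; no `sorry`, nothing registered) -/

/-- **S3⁺ — the `3`–`5` switch with `5`-adic control** (Wiles 1995 Ch. 5 / Stevens CSS 1997 (7.10):
the `E[5]`-twist of `X(5)` is `ℙ¹/ℚ`; Hilbert irreducibility with a `5`-adic congruence condition on the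
parameter gives `E'` with `E'[5] ≅ E[5]`, `E'[3]` absolutely irreducible over `ℚ(√-3)` AND an integral
equation congruent mod `5` to `y² = x(x − A)(x + B)`, hence multiplicative at `5` by
`hasMultiplicativeReductionAtPrime_five_of_map_eq_freyIntModel`).  The registered `stub_switch`
(`CDT_three_five_switch`) is this without the last hypothesis and the middle conclusion.
[cite: StevensCSS1997, (7.10)] [cite: Wiles1995Annals, Ch. 5] -/
def SwitchMultFive : Prop :=
  ∀ (W : WeierstrassCurve ℚ) [W.IsElliptic], ¬ 27 ∣ W.conductorNorm ℤ →
    (∀ ρ₃ : ModPGaloisRep ℚ (ZMod 3) 2, W.IsTorsionGaloisRep 3 ρ₃ →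
      ¬ ρ₃.IsAbsIrreducibleOverSqrt (-3)) →
    ∀ (ρ : ModPGaloisRep ℚ (ZMod 5) 2), W.IsTorsionGaloisRep 5 ρ → ρ.IsAbsIrreducibleOverSqrt 5 →
    W.HasMultiplicativeReductionAtPrime 5 →
    ∃ (W' : WeierstrassCurve ℚ) (_ : W'.IsElliptic), W'.IsTorsionGaloisRep 5 ρ ∧
      W'.HasMultiplicativeReductionAtPrime 5 ∧
      ∃ ρ₃' : ModPGaloisRep ℚ (ZMod 3) 2, W'.IsTorsionGaloisRep 3 ρ₃' ∧
        ρ₃'.IsAbsIrreducibleOverSqrt (-3)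

end Summit.ABC.ABC.Cruxes.FreyModularity.StubIdeas.LiftFive3g5

end
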